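import Summits.ABC.IUTFork.Cor312VolumesPadicPerm
import Summits.ABC.IUTFork.Thm311RealLog
import Literature.IUT.LogVolume.RationalPacketComparison
import HarnessLib

/-!
# [IUTchIII] Corollary 3.12, statement — the verbatim container on the REAL log-shells of a number field:
# the `p`-adic presentation of c312-5's Dupuy–Hilado-level signature, (Ind1)/(Ind2) invariance UNCONDITIONAL

Record-only file (D-0012) of the abc-iut cell (Cor. 3.12 sub-crew, seat abc-iut-c312-5, gen 2; D-0067 TEAM A row
A-0); TAKES NO SIDE. `Cor312VolumesPadicSummands`/`…PadicPerm` prove the (Ind1)/(Ind2) generator facts of the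
verbatim mono-analytic container ([IUTchIII] Rmk. 3.1.1 (ii)(iii), kurims `paper:url-4b091feeb646` pp. 94–96) on
abc-iut-c312-3's real prime packets for ANY `p`-adic presentation of c312-1's log-shell carriers. THIS file
SUPPLIES THE PRESENTATION for the REAL signature of the cell at the Dupuy–Hilado level — c312-5's (gen 1)
`Real.logShellsDH X logv` (`Thm311RealDH`: carriers `K_v = v.adicCompletion F` of the number field `F` of
c312-3's `PilotData`, log-shells `I_v = (p_v^*)⁻¹·log_v(𝒪_v^×)` of abc-iut-L6-t3 over a family `logv` of `p_v`-adic
logarithms, (Ind1) = capsule permutations (`stripAutDH = {1}`, Dupuy–Hilado §4.7), (Ind2) = the bicontinuous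
`ℚ`-linear automorphisms of `K_v` fixing `I_v` (`ismDH`, Dupuy–Hilado §4.9)) — whenever `logv` IS the analytic
logarithm over `p` (`LogvAnalyticAt`; satisfied by c312-5's `Real.analyticLogv`, i.e. abc-iut-L5-t5's
`AdicCompletionLogShell` = campaign-S `unitLog`, `logvAnalyticAt_analyticLogv`):

* `K_v` presented as abc-iut-S7's `RescaledCompletion F p v` (the SAME field and topology, normed by
  `‖·‖_v^{1/n_v}` so as to be a normed `ℚ_p`-algebra — the MLF class of c312-3's `LocalFields`), `φ_v = id`;
* `shell_eq`: `I_v = (p^*)⁻¹ • log_p(𝒪^×)` with campaign-S `logUnits` (units of `𝒪_v` = norm-one elements);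
* `ism_linear`: a CONTINUOUS additive automorphism of `K_v` is `ℚ_p`-linear (campaign-S
  `map_padic_smul_of_continuous`: `ℚ` is dense in `ℚ_p`); `ism_shell` is the definition of `ismDH`;
* weights: at this level (`F` in the role of both `K` and `F_mod`, [IUTchIII] Rmk. 3.1.1 (ii)) the normalized
  weight of every summand `v⃗` of the `(j+1)`-packet over `p` is the constant `1/[F:ℚ]^{j+1}`
  (`Σ_{w⃗} Π_a [F_{w_a}:ℚ_p] = [F:ℚ]^{j+1}`, abc-iut-L6-t4 `sum_prod_degF_eq_pow`), trivially symmetric;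
whence **`Real.generatorsPreserveDH`**: for the verbatim container on the real prime packets
`F_{v_0} ⊗_{ℚ_p} ⋯ ⊗_{ℚ_p} F_{v_j}` of Dupuy–Hilado Def. 3.6.1, every capsule permutation and every family of
Dupuy–Hilado (Ind2)-automorphisms carries direct product regions to direct product regions OF THE SAME weighted
log-volume — [IUTchIII] proof of Cor. 3.12, Step (x), p. 181 "invariant with respect to the indeterminacies
(Ind1), (Ind2)" / Dupuy–Hilado §4.9 footnote "the measure of sets are preserved", as a THEOREM about the real
log-shells of `F`, with no binder left at `v_ℚ = p` except the (existentially discharged) analytic logarithm.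
[claim: Mochizuki2012, status: disputed] for the quoted container; [cite: DupuyHilado2025, §4.7, §4.9];
[cite: NeukirchANT1999, Ch. II (5.5)] for the logarithm. Deliberately NOT here: the archimedean place, the
assembly over all places and the `Cor312.Setting` (next file), Θ-boxes, any judgement.
-/

noncomputable section

open Set Function NumberField IsDedekindDomain
open scoped Pointwise

namespace Summit.ABC

namespace IUTFork

namespace Thm311

namespace Real

open Cor312Vol Literature.IUT.LogThetaLattice Literature.IUT.LogVolume Literature.NumberTheory.NumberFields

variable {F : Type} [Field F] [NumberField F] (X : PilotData F) (p : ℕ) [hp : Fact p.Prime]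

/-- The prime `p` as an element of `V_ℚ^non` (c312-5's `RatPlace = Unit ⊕ Nat.Primes`). [folklore] -/
abbrev ratPrime : Nat.Primes := ⟨p, hp.out⟩

/-! ## 1. The fibre over `p` and the rescaled completions -/

/-- The finite place `v` underlying an element of the fibre of `V(F) → V_ℚ` over `p` (c312-5's
`fibreEquivPlacesOver`: the fibre IS c312-3's `V(F)_p`). [folklore] -/
def placeOf (x : (thetaIndex X).Fibre (.inr (ratPrime p))) : HeightOneSpectrum (𝓞 F) :=
  (fibreEquivPlacesOver X (ratPrime p) x).1

/-- `placeOf x ∈ V(F)_p`. [folklore] -/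
theorem placeOf_mem (x : (thetaIndex X).Fibre (.inr (ratPrime p))) : placeOf X p x ∈ placesOver F p :=
  (fibreEquivPlacesOver X (ratPrime p) x).2

/-- `p ∈ 𝔭_v` for `v` in the fibre over `p`. [folklore] -/
theorem natCast_mem_placeOf (x : (thetaIndex X).Fibre (.inr (ratPrime p))) :
    ((p : ℕ) : 𝓞 F) ∈ (placeOf X p x).asIdeal := by
  have h := (mem_placesOver_iff (placeOf X p x)).mp (placeOf_mem X p x)
  have hmem : ((p : ℕ) : ℤ) ∈ (placeOf X p x).asIdeal.under ℤ := by
    rw [← h.over]; exact Ideal.mem_span_singleton_self _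
  simpa using Ideal.mem_comap.mp hmem

/-- **`K_v` as a field of the MLF class**: abc-iut-S7's `RescaledCompletion F p v` — the completion
`v.adicCompletion F` (the SAME type, field and topology as c312-5's `Real.Carrier (inr v)`) normed by
`‖·‖_v^{1/n_v}`, a normed `ℚ_p`-algebra, ultrametric, proper. [cite: NeukirchANT1999, Ch. II Thm. (4.8)] -/
abbrev kOf (x : (thetaIndex X).Fibre (.inr (ratPrime p))) : Type :=
  RescaledCompletion F p (placeOf X p x) (natCast_mem_placeOf X p x)

/-- The `ℚ`-module structure of `K_v`: THAT OF c312-5's carrier `Real.Carrier (inr v)` (the rescaled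
completion carries none of its own; `ℚ`-module structures are unique anyway). [folklore] -/
@[reducible] def kOfRatModule : ∀ x : (thetaIndex X).Fibre (.inr (ratPrime p)), Module ℚ (kOf X p x)
  | ⟨.inr v, _⟩ => (inferInstance : Module ℚ (Carrier (.inr v : Place F)))
  | ⟨.inl _, h⟩ => absurd h (by simp [thetaIndex])

/-- **`φ_v = id`**: the carrier `log(𝒟^⊢_v) = K_v` of c312-5's real signature IS the rescaled completion, as a
`ℚ`-module. [folklore] -/
def φOf (logv : PadicLogs F) :
    ∀ x : (thetaIndex X).Fibre (.inr (ratPrime p)),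
      letI := kOfRatModule X p x; (logShellsDH X logv).carrier x.1 ≃ₗ[ℚ] kOf X p x
  | ⟨.inr v, _⟩ => LinearEquiv.refl ℚ (Carrier (.inr v : Place F))
  | ⟨.inl _, h⟩ => absurd h (by simp [thetaIndex])

/-! ## 2. The analytic logarithm hypothesis and the log-shell -/

/-- The identity `K_v → (rescaled completion)`: c312-5's carrier `Real.Carrier (inr v)` and abc-iut-S7's
`RescaledCompletion F p v` are the same type (written as a function so that both typings stay visible). [folklore] -/
def toR (v : HeightOneSpectrum (𝓞 F)) (hv : ((p : ℕ) : 𝓞 F) ∈ v.asIdeal) :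
    Carrier (.inr v : Place F) → RescaledCompletion F p v hv := fun x => x

/-- The identity `(rescaled completion) → K_v`. [folklore] -/
def ofR (v : HeightOneSpectrum (𝓞 F)) (hv : ((p : ℕ) : 𝓞 F) ∈ v.asIdeal) :
    RescaledCompletion F p v hv → Carrier (.inr v : Place F) := fun x => x

/-- **The family `logv` is the ANALYTIC `p`-adic logarithm at the places over `p`**: `log_v(u) = log_p(u)`
(campaign-S `unitLog` evaluated in the rescaled field; [IUTchIII] Def. 1.1 (i) "`log_k`", [AbsTopIII] Def. 3.1;
Neukirch ANT II (5.5)). Satisfied by c312-5's `Real.analyticLogv` (`logvAnalyticAt_analyticLogv`).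
[cite: NeukirchANT1999, Ch. II (5.5)] -/
def LogvAnalyticAt (logv : PadicLogs F) : Prop :=
  ∀ (v : HeightOneSpectrum (𝓞 F)) (hv : ((p : ℕ) : 𝓞 F) ∈ v.asIdeal) (u : (↥(integers v))ˣ),
    logv v (Additive.ofMul u) =
      ofR p v hv (unitLog (toR p v hv ((u : ↥(integers v)) : Carrier (.inr v : Place F))))

omit [NumberField F] in
/-- Two rational primes in the same proper ideal coincide. [folklore] -/
theorem eq_of_natCast_mem_of_prime {I : Ideal (𝓞 F)} (hI : I ≠ ⊤) {q : ℕ} (hq : q.Prime)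
    (hqI : ((q : ℕ) : 𝓞 F) ∈ I) (hpI : ((p : ℕ) : 𝓞 F) ∈ I) : q = p := by
  by_contra hne
  have hcop : Nat.Coprime q p := (Nat.coprime_primes hq hp.out).mpr hne
  obtain ⟨a, b, hab⟩ := Nat.isCoprime_iff_coprime.mpr hcop
  have h1 : (1 : 𝓞 F) ∈ I := by
    have : ((a * (q : ℤ) + b * (p : ℤ) : ℤ) : 𝓞 F) = 1 := by rw [hab]; simp
    rw [← this]
    push_cast
    exact I.add_mem (I.mul_mem_left _ hqI) (I.mul_mem_left _ hpI)
  exact hI ((Ideal.eq_top_iff_one _).mpr h1)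

omit [NumberField F] in
/-- The residue characteristic of a place containing `p` is `p`. [folklore] -/
theorem residueChar_eq_of_natCast_mem {v : HeightOneSpectrum (𝓞 F)} (hv : ((p : ℕ) : 𝓞 F) ∈ v.asIdeal) :
    residueChar F v = p :=
  eq_of_natCast_mem_of_prime p v.isPrime.ne_top (residueChar_prime F v) (natCast_residueChar_mem F v) hv

/-- c312-5's analytic logarithm family (`Thm311RealLog`, from abc-iut-L5-t5's `AdicCompletionLogShell`) IS
analytic at every `p`. [cite: NeukirchANT1999, Ch. II (5.5)] -/
theorem logvAnalyticAt_analyticLogv : LogvAnalyticAt (F := F) p (analyticLogv F) := by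
  intro v hv u
  have e := residueChar_eq_of_natCast_mem p hv
  subst e
  exact analyticLogv_apply F v u

section Shell

variable {p}
variable (v : HeightOneSpectrum (𝓞 F)) (hv : ((p : ℕ) : 𝓞 F) ∈ v.asIdeal)

omit hp in
/-- A unit of `𝒪_v` has rescaled norm `1`. [cite: NeukirchANT1999, Ch. II Prop. (3.3)] -/
theorem norm_of_unit (u : (↥(integers v))ˣ) :
    ‖toR p v hv ((u : ↥(integers v)) : Carrier (.inr v : Place F))‖ = 1 := by
  have h2 : ‖((u : ↥(integers v)) : Carrier (.inr v : Place F))‖ = 1 :=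
    norm_coe_unit_adicCompletionIntegers F v u
  calc ‖toR p v hv ((u : ↥(integers v)) : Carrier (.inr v : Place F))‖
      = ‖((u : ↥(integers v)) : Carrier (.inr v : Place F))‖ ^ (1 / (localDeg F v : ℝ)) :=
        RescaledCompletion.norm_of F p v hv _
    _ = 1 := by rw [h2, Real.one_rpow]

omit hp in
/-- An element of rescaled norm `1` is (the image of) a unit of `𝒪_v`. [cite: NeukirchANT1999, Ch. II Prop. (3.3)] -/
theorem exists_unit_of_norm_eq_one {y : RescaledCompletion F p v hv} (hy : ‖y‖ = 1) :
    ∃ u : (↥(integers v))ˣ, toR p v hv ((u : ↥(integers v)) : Carrier (.inr v : Place F)) = y := by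
  have hy0 : y ≠ 0 := fun h => by rw [h, norm_zero] at hy; exact zero_ne_one hy
  have hmem : y ∈ (v.adicCompletionIntegers F : ValuationSubring (RescaledCompletion F p v hv)) :=
    (mem_integers_iff_norm_rescaled_le_one F p v hv y).mpr hy.le
  have hmem' : y⁻¹ ∈ (v.adicCompletionIntegers F : ValuationSubring (RescaledCompletion F p v hv)) :=
    (mem_integers_iff_norm_rescaled_le_one F p v hv _).mpr (by rw [norm_inv, hy, inv_one])
  exact ⟨Units.mkOfMulEqOne (⟨y, hmem⟩ : ↥(v.adicCompletionIntegers F)) ⟨y⁻¹, hmem'⟩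
    (Subtype.ext (mul_inv_cancel₀ hy0)), rfl⟩

/-- **The log-shell of the real signature is `(p^*)⁻¹·log_p(𝒪^×)`**: at a place `v` over `p` where `logv` is
the analytic logarithm, membership in c312-5's `Real.shell logv (inr v) = (p_v^*)⁻¹·log_v(𝒪_v^×)` ([IUTchIII]
Def. 1.1 (i), Rmk. 1.2.2 (i) p. 36; abc-iut-L6-t3 `nonarchLogShell`) is, read in the rescaled field (same
underlying set), membership in the scalar multiple `(p^*)⁻¹ • logUnits` of campaign-S's `log_p(𝒪^×)`.
[claim: Mochizuki2012, status: disputed] -/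
theorem mem_shell_iff_mem_smul_logUnits {logv : PadicLogs F} (hlog : LogvAnalyticAt p logv)
    (a : RescaledCompletion F p v hv) :
    ofR p v hv a ∈ shell logv (.inr v) ↔ a ∈ ((pStar p : ℕ) : ℚ_[p])⁻¹ • logUnits (RescaledCompletion F p v hv) := by
  have hres : residueChar F v = p := residueChar_eq_of_natCast_mem p hv
  have hc : algebraMap ℚ_[p] (RescaledCompletion F p v hv) ((pStar p : ℕ) : ℚ_[p])⁻¹ =
      ((pStar p : ℕ) : RescaledCompletion F p v hv)⁻¹ := by
    rw [map_inv₀, map_natCast]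
  rw [shell_inr, hres, Set.mem_smul_set]
  constructor
  · rintro ⟨u, hu⟩
    refine ⟨unitLog (toR p v hv ((u : ↥(integers v)) : Carrier (.inr v : Place F))),
      ⟨_, norm_of_unit v hv u, rfl⟩, ?_⟩
    rw [Algebra.smul_def, hc]
    rw [hlog v hv u] at hu
    exact (congrArg (toR p v hv) hu).symm
  · rintro ⟨z, ⟨y, hy, rfl⟩, rfl⟩
    obtain ⟨u, rfl⟩ := exists_unit_of_norm_eq_one v hv hy
    refine ⟨u, ?_⟩
    rw [hlog v hv u, Algebra.smul_def, hc]
    rfl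

end Shell

/-! ## 3. The presentation and the generator facts for the real log-shells -/

/-- The NORMALIZED WEIGHT of every summand `v⃗` of the `(j+1)`-packet over `p` at the Dupuy–Hilado level (`F`
playing both `K` and `F_mod` in [IUTchIII] Rmk. 3.1.1 (ii), third display): `1/(Σ_{w⃗} Π_a [F_{w_a}:ℚ_p]) =
1/[F:ℚ]^{j+1}` (abc-iut-L6-t4 `sum_prod_degF_eq_pow`), independent of `v⃗`. [claim: Mochizuki2012, status: disputed] -/
def weightDH (j : (thetaIndex X).Label) : ℝ := ((Module.finrank ℚ F : ℝ) ^ ((j : ℕ) + 1))⁻¹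

/-- The weight is nonnegative. [folklore] -/
theorem weightDH_nonneg (j : (thetaIndex X).Label) : 0 ≤ weightDH X j := by
  unfold weightDH; positivity

/-- A continuous additive automorphism of `K_v` is `ℚ_p`-linear on the rescaled completion (campaign-S
`map_padic_smul_of_continuous`: `ℚ` is dense in `ℚ_p`; the topology of the rescaled completion is that of
`K_v`). [folklore] -/
def padicLinearOf (v : HeightOneSpectrum (𝓞 F)) (hv : ((p : ℕ) : 𝓞 F) ∈ v.asIdeal)
    (g : Carrier (.inr v : Place F) ≃ₗ[ℚ] Carrier (.inr v : Place F)) (hg : Continuous g) :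
    RescaledCompletion F p v hv ≃ₗ[ℚ_[p]] RescaledCompletion F p v hv :=
  let e : RescaledCompletion F p v hv ≃+ RescaledCompletion F p v hv := g.toAddEquiv
  have he : Continuous e := hg
  { e with map_smul' := fun c x => map_padic_smul_of_continuous p e.toAddMonoidHom he c x }

/-- `padicLinearOf g` acts as `g`. [folklore] -/
theorem padicLinearOf_apply (v : HeightOneSpectrum (𝓞 F)) (hv : ((p : ℕ) : 𝓞 F) ∈ v.asIdeal)
    (g : Carrier (.inr v : Place F) ≃ₗ[ℚ] Carrier (.inr v : Place F)) (hg : Continuous g)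
    (x : Carrier (.inr v : Place F)) : padicLinearOf p v hv g hg x = g x := rfl

/-- **The `p`-adic presentation of the real Dupuy–Hilado-level signature** `Real.logShellsDH X logv` over
`v_ℚ = p`, for `logv` analytic over `p`: `K_v` = the rescaled completion, `φ_v = id`, `c = (p^*)⁻¹`,
`Ism`-elements `ℚ_p`-linear (continuity) and shell-preserving (definition of `ismDH`), strip-automorphisms
trivial, weights `1/[F:ℚ]^{j+1}`. [claim: Mochizuki2012, status: disputed] -/
def padicPresentationDH (logv : PadicLogs F) (hlog : LogvAnalyticAt p logv) :
    PadicPresentation (logShellsDH X logv) (.inr (ratPrime p)) p where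
  k := kOf X p
  instField x := inferInstanceAs (NontriviallyNormedField (RescaledCompletion F p _ _))
  instAlg x := inferInstanceAs (NormedAlgebra ℚ_[p] (RescaledCompletion F p _ _))
  instUltra x := inferInstanceAs (IsUltrametricDist (RescaledCompletion F p _ _))
  instProper x := inferInstanceAs (ProperSpace (RescaledCompletion F p _ _))
  instRat := kOfRatModule X p
  φ := φOf X p logv
  c := ((pStar p : ℕ) : ℚ_[p])⁻¹
  c_ne_zero := inv_ne_zero (Nat.cast_ne_zero.mpr (pStar_ne_zero hp.out.ne_zero))
  shell_eq := by
    rintro ⟨x1, h⟩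
    rcases x1 with w | v
    · exact absurd h (by simp [thetaIndex])
    · ext a
      have key := mem_shell_iff_mem_smul_logUnits v (natCast_mem_placeOf X p ⟨.inr v, h⟩) hlog a
      refine ⟨?_, fun ha => ⟨ofR p v _ a, key.2 ha, rfl⟩⟩
      rintro ⟨b, hb, hba⟩
      have hba' : b = ofR p v (natCast_mem_placeOf X p ⟨.inr v, h⟩) a := hba
      subst hba'
      exact key.1 hb
  strip_linear := by
    rintro ⟨x1, h⟩ g hg
    rcases x1 with w | v
    · exact absurd h (by simp [thetaIndex])
    · have hg' : g = LinearEquiv.refl ℚ _ := hg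
      subst hg'
      exact ⟨LinearEquiv.refl ℚ_[p] _, fun _ => rfl⟩
  strip_shell := by
    rintro x g hg
    have hg' : g = LinearEquiv.refl ℚ _ := hg
    subst hg'
    simp
  ism_linear := by
    rintro ⟨x1, h⟩ g hg
    rcases x1 with w | v
    · exact absurd h (by simp [thetaIndex])
    · exact ⟨padicLinearOf p v (natCast_mem_placeOf X p ⟨.inr v, h⟩) g hg.1, fun _ => rfl⟩
  ism_shell := by
    rintro ⟨x1, h⟩ g hg
    rcases x1 with w | v
    · exact absurd h (by simp [thetaIndex])
    · exact hg.2.2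
  w := fun j _ => weightDH X j
  w_nonneg := fun j _ => weightDH_nonneg X j
  w_perm := fun _ _ _ => rfl

/-- **(Ind1)/(Ind2) INVARIANCE OF THE VERBATIM CONTAINER ON THE REAL LOG-SHELLS, UNCONDITIONAL at `v_ℚ = p`**:
for c312-5's Dupuy–Hilado-level signature `Real.logShellsDH X logv` with `logv` analytic over `p` (e.g.
`Real.analyticLogv`), the local pieces on the real prime packets `F_{v_0} ⊗_{ℚ_p} ⋯ ⊗_{ℚ_p} F_{v_j}` satisfy
`GeneratorsPreserve`: every capsule permutation ((Ind1), Dupuy–Hilado §4.7) and every family of bicontinuous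
shell-preserving automorphisms ((Ind2), §4.9) carries direct product regions to direct product regions of the
same weighted log-volume ([IUTchIII] proof of Cor. 3.12, Step (x), p. 181: "invariant with respect to the
indeterminacies (Ind1), (Ind2)"). [cite: DupuyHilado2025, §4.7, §4.9] -/
theorem generatorsPreserveDH (logv : PadicLogs F) (hlog : LogvAnalyticAt p logv) :
    (padicPresentationDH X p logv hlog).toLocalPieces.GeneratorsPreserve :=
  (padicPresentationDH X p logv hlog).generatorsPreserve_toLocalPieces

/-- The same for the ANALYTIC logarithm family `Real.analyticLogv` — no hypothesis left.
[cite: DupuyHilado2025, §4.7, §4.9] -/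
theorem generatorsPreserveDH_analytic :
    (padicPresentationDH X p (analyticLogv F) (logvAnalyticAt_analyticLogv p)).toLocalPieces.GeneratorsPreserve :=
  generatorsPreserveDH X p _ _

end Real

end Thm311

end IUTFork

end Summit.ABC

end
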